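import Literature.NumberTheory.EllipticCurves.LocalTorsionUnramifiedProofs
import Summits.BirchSwinnertonDyer.Rank1Residual.Additive.CuspDivisionPolynomialFiveSeven
import Mathlib.Analysis.Normed.Ring.Ultra
import HarnessLib

/-!
# No `5`- or `7`-torsion with INTEGRAL abscissa on `y² = x³ + ax + b` over an arbitrary ultrametric
# field, off the Kosters–Pannekoek valuations (`‖a‖ ≤ ‖5‖²`, `‖b‖ ≤ ‖5‖` resp. `‖a‖ ≤ ‖7‖`, `‖b‖ ≤ ‖7‖²`)
# — the unit-abscissa half of the receptacle of line `kato-lever` over UNRAMIFIED `p`-adic fields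

Route `EdixhovenFibreFiveSeven`, crux K★ `StarredOptimalManinUnitFiveSeven` (stmt-BirchSwinnertonDyer-22226),
line `kato-lever`, seat `bsd-line-edix-p1` g4; `--supports` 22226 (helper toward the ONE open stub F″ =
`Literature.NumberTheory.EllipticCurves.kato_neron_isIntegral_twistedSymbolSum_of_additive_five_le`, programme
piece P2 of `Cruxes/StarredOptimalManinUnitFiveSeven/Lines/kato-lever-F2-programme.md`). TOOL theorems only (no
definition, no named fact, no `sorry`); nothing is closed or booked; BSD is not proved by any of this.

WHY. F″ is Kato's (8.1.3)/Thm 9.7/Thm 6.6(1) read in Néron units through the Kim–Nakamura / Kosters–Pannekoek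
RECEPTACLE `log_ω : E₀(K_v) ⊗ ℤ_p ≅ O_{K_v}` at the completions `K_v = ℚ(ζ_m)_v`, `v ∣ p`, which are UNRAMIFIED
over `ℚ_p` of degree `f_v = ord_m p ≥ 1` — not `ℚ_p` itself. The receptacle needs `E₀(K_v)[p] = 0`. The tree
proves the absence of `p`-torsion at an additive `p ≥ 5` over `ℚ_p` only
(`Rank1Residual.Additive.eq_zero_of_prime_nsmul_eq_zero_of_addv_of_four_le`, via the `ℤ_[p]`-typed
`CuspTorsion.not_prime_zsmul_eq_zero_of_norm_eq_one_five/_seven`), and the kernel-of-reduction case over any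
unramified field (`UnramifiedKernelTorsion.not_prime_zsmul_eq_zero_of_one_lt_norm_unramified`). This file adds
the UNIT-ABSCISSA case over an ARBITRARY ultrametric normed field `K` (no unramifiedness, no completeness, no
residue-field hypothesis): the integer congruences `ψ₅ ≡ 5x¹² + 380·b·x⁹ (mod (a, b²))` and
`ψ₇ ≡ 7x²⁴ + 308·a·x²² (mod (a², b))` of `CuspDivisionPolynomialFiveSeven`, lifted to identities of
POLYNOMIALS over the coefficient ring `R` (evaluate at `X` over `R[X]`), give
`ψ_p(x) = p·x^{(p²−1)/2} + (terms of norm ≤ ‖p‖²)` at `‖x‖ = 1`, hence `ψ_p(x) ≠ 0`, hence `p • P ≠ O`.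
On K★'s locus (`4 < v_pΔ_min`, indeed on `4 ≤ v_pΔ_min`: `v_p(c₄), v_p(c₆) ≥ 2`) the short minimal model
`y² = x³ − (c₄/48)x − c₆/864` has `‖a‖, ‖b‖ ≤ ‖p‖²` in EVERY extension of `ℚ_p`, so together with the kernel
case the points of `E₀(K) ∖ {O}` (abscissa of norm `≥ 1` … `= 1` off the kernel) carry no `p`-torsion over
every unramified `K ⊇ ℚ_p` — the Kosters–Pannekoek invariant `ā` vanishes there, whatever the residue degree.

* `norm_eval_map_le_one` — an `R`-integral polynomial has norm `≤ 1` at `‖x‖ ≤ 1`.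
* `exists_preΨ'_five_eq`, `exists_preΨ'_seven_eq` — `ψ₅ = 5X¹² + 380bX⁹ + aU + b²V`,
  `ψ₇ = 7X²⁴ + 308aX²² + a²U + bV` in `R[X]`.
* `not_five_zsmul_eq_zero_of_norm_eq_one`, `not_seven_zsmul_eq_zero_of_norm_eq_one` — unit abscissa, any
  ultrametric `K`.
* `not_zsmul_eq_zero_of_one_le_norm_unramified` — `p ∈ {5, 7}`, `‖a‖, ‖b‖ ≤ ‖p‖²`, `K` unramified
  (`‖z‖ < 1 ⇒ ‖z‖ ≤ ‖p‖`): no point with `‖x‖ ≥ 1` is killed by `p` (unit case here + kernel case of the tree).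

References: [SilvermanAEC2009] J. H. Silverman, *The Arithmetic of Elliptic Curves*, 2nd ed., Exercise 3.7
(d),(f), VII.3.1; [KostersPannekoek2017] M. Kosters, R. Pannekoek, arXiv:1703.07888, Thm. 1 (iii)/(iv), Cor. 2
(the exceptional valuations `a₄ ≡ 10 (25)`, `a₆ ≡ 14 (49)` excluded here by `‖a‖ ≤ ‖5‖²`, `‖b‖ ≤ ‖7‖²`);
[KimNakamura2020] C.-H. Kim, K. Nakamura, J. Number Theory 210 (2020), Thm. 2.1, Remark 1.8 (1) (the receptacle
over unramified `K`); [Mazur1977] Ch. III §5 Step 1 (method).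
-/

set_option autoImplicit false
-- the Theorems namespace of a single-conjunct summit repeats the summit name by design (D-0017)
set_option linter.dupNamespace false

noncomputable section

open scoped Classical
open _root_.WeierstrassCurve _root_.Polynomial
open Literature.NumberTheory.EllipticCurves Literature.NumberTheory.EllipticCurves.CuspJets
open Summit.BirchSwinnertonDyer.Rank1Residual.Additive.CuspTorsion

namespace Summit.BirchSwinnertonDyer.BirchSwinnertonDyer.Theorems.StarredOptimalManinUnitFiveSevenUnramifiedTorsion

variable {K : Type*} [NontriviallyNormedField K] [IsUltrametricDist K]
  {R : Type*} [CommRing R] (f : R →+* K)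

/-! ## §1 Integral polynomials at integral points -/

/-- **An `R`-integral polynomial has norm `≤ 1` at a point of norm `≤ 1`** (`‖f r‖ ≤ 1` for all `r`,
ultrametric inequality on the sum of monomials). [folklore] -/
theorem norm_eval_map_le_one (hf : ∀ r, ‖f r‖ ≤ 1) (U : R[X]) {x : K} (hx : ‖x‖ ≤ 1) :
    ‖(U.map f).eval x‖ ≤ 1 := by
  rw [eval_eq_sum_range]
  refine IsUltrametricDist.norm_sum_le_of_forall_le_of_nonneg zero_le_one fun i _ => ?_
  rw [norm_mul, norm_pow, coeff_map]
  exact mul_le_one₀ (hf _) (by positivity) (pow_le_one₀ (norm_nonneg _) hx)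

/-! ## §2 `ψ₅` and `ψ₇` of the short curve as polynomials over `R` -/

/-- `((Q.map C).eval X) = Q` for `Q ∈ R[X]`. [folklore] -/
private theorem eval_X_map_C (Q : R[X]) : (Q.map (C : R →+* R[X])).eval X = Q := by
  rw [eval_map, eval₂_C_X]

/-- **`ψ₅ = 5X¹² + 380·b·X⁹ + a·U + b²·V` in `R[X]`** for `y² = x³ + ax + b` (the congruence
`CuspTorsion.eval_preΨ'_five_sub_mem` applied over the ring `R[X]` at the point `X`).
[cite: SilvermanAEC2009, Exercise 3.7 (PDF pp. 97–98)] -/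
theorem exists_preΨ'_five_eq (a b : R) : ∃ U V : R[X],
    (shortCurve a b).preΨ' 5 = 5 * X ^ 12 + C (380 * b) * X ^ 9 + C a * U + C (b ^ 2) * V := by
  have h := eval_preΨ'_five_sub_mem (C a : R[X]) (C b) X
  rw [← map_shortCurve, WeierstrassCurve.map_preΨ', eval_X_map_C, Ideal.mem_span_pair] at h
  obtain ⟨u, v, huv⟩ := h
  refine ⟨u, v, ?_⟩
  rw [map_mul, map_pow, C_ofNat] at *
  linear_combination -huv

/-- **`ψ₇ = 7X²⁴ + 308·a·X²² + a²·U + b·V` in `R[X]`** for `y² = x³ + ax + b`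
(`CuspTorsion.eval_preΨ'_seven_sub_mem` over `R[X]` at `X`). [cite: SilvermanAEC2009, Exercise 3.7 (PDF pp. 97–98)] -/
theorem exists_preΨ'_seven_eq (a b : R) : ∃ U V : R[X],
    (shortCurve a b).preΨ' 7 = 7 * X ^ 24 + C (308 * a) * X ^ 22 + C (a ^ 2) * U + C b * V := by
  have h := eval_preΨ'_seven_sub_mem (C a : R[X]) (C b) X
  rw [← map_shortCurve, WeierstrassCurve.map_preΨ', eval_X_map_C, Ideal.mem_span_pair] at h
  obtain ⟨u, v, huv⟩ := h
  refine ⟨u, v, ?_⟩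
  rw [map_mul, map_pow, C_ofNat] at *
  linear_combination -huv

/-! ## §3 From `p • P = O` to `ψ_p(x) = 0` -/

omit [IsUltrametricDist K] in
/-- On `W₀ ⊗_f K`, if an affine point `(x, y)` is killed by an odd prime `p` then
`ψ_p(x) = ((W₀.preΨ' p).map f).eval x = 0` (`p • P = O ↔ ψ_p(P) = 0`, `ψ_p² = preΨ'_p²` for odd `p`).
[cite: SilvermanAEC2009, Exercise 3.7(d),(f) (PDF pp. 97–98)] -/
theorem eval_map_preΨ'_eq_zero_of_zsmul_eq_zero (W₀ : WeierstrassCurve R) [(W₀.map f).IsElliptic]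
    {p : ℕ} (hodd : ¬ Even p) {x y : K} (h : (W₀.map f).toAffine.Nonsingular x y)
    (h0 : (p : ℤ) • (Affine.Point.some x y h : (W₀.map f).toAffine.Point) = 0) :
    ((W₀.preΨ' p).map f).eval x = 0 := by
  rw [zsmul_eq_zero_iff_evalEval_ψ_holds (W₀.map f) (p : ℤ) h] at h0
  have h1 := evalEval_ψ_sq (W₀.map f) h.1 (p : ℤ)
  rw [h0, zero_pow two_ne_zero, ΨSq_ofNat, if_neg hodd, mul_one, eval_pow, eq_comm,
    pow_eq_zero_iff two_ne_zero, WeierstrassCurve.map_preΨ'] at h1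
  exact h1

/-! ## §4 The unit-abscissa case at `5` and at `7` (any ultrametric `K`) -/

omit [IsUltrametricDist K] in
/-- Leading-term domination at a unit: if `‖t‖ ≤ ‖c‖²` with `0 < ‖c‖ < 1` and `‖x‖ = 1` then
`c·x^n + t ≠ 0`. [folklore] -/
private theorem ne_zero_of_norm_le_sq {c t x : K} (hc0 : c ≠ 0) (hc1 : ‖c‖ < 1) (hx : ‖x‖ = 1) (n : ℕ)
    (ht : ‖t‖ ≤ ‖c‖ ^ 2) : c * x ^ n + t ≠ 0 := by
  intro h
  have hc : 0 < ‖c‖ := norm_pos_iff.mpr hc0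
  have h1 : ‖c * x ^ n‖ = ‖c‖ := by rw [norm_mul, norm_pow, hx, one_pow, mul_one]
  rw [add_eq_zero_iff_eq_neg] at h
  rw [h, norm_neg] at h1
  rw [h1] at ht
  nlinarith

/-- **No `5`-torsion with unit abscissa off the Kosters–Pannekoek valuation at `5`.** On
`y² = x³ + ax + b` with coefficients in `R`, read in ANY ultrametric normed field `K` through `f : R → K`
with `‖f r‖ ≤ 1`, `0 < ‖5‖ < 1`, `‖f a‖ ≤ ‖5‖²` and `‖f b‖ ≤ ‖5‖`: a point `(x, y)` with `‖x‖ = 1` is not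
killed by `5`. Proof: `ψ₅(x) = 5x¹² + 380·b·x⁹ + a·U(x) + b²·V(x)` and the last three terms have norm
`≤ ‖5‖²` (`380 = 5·76`). [cite: SilvermanAEC2009, Exercise 3.7(d),(f)] [cite: KostersPannekoek2017, Thm. 1 (iii) and Cor. 2 (iii)] -/
theorem not_five_zsmul_eq_zero_of_norm_eq_one (hf : ∀ r, ‖f r‖ ≤ 1) {a b : R}
    [((shortCurve a b).map f).IsElliptic] (h50 : (5 : K) ≠ 0) (h51 : ‖(5 : K)‖ < 1)
    (ha : ‖f a‖ ≤ ‖(5 : K)‖ ^ 2) (hb : ‖f b‖ ≤ ‖(5 : K)‖) {x y : K}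
    (h : ((shortCurve a b).map f).toAffine.Nonsingular x y) (hx : ‖x‖ = 1) :
    (5 : ℤ) • (Affine.Point.some x y h : ((shortCurve a b).map f).toAffine.Point) ≠ 0 := by
  intro h0
  have h1 := eval_map_preΨ'_eq_zero_of_zsmul_eq_zero f (shortCurve a b) (p := 5) (by decide) h
    (by exact_mod_cast h0)
  obtain ⟨U, V, hUV⟩ := exists_preΨ'_five_eq a b
  rw [hUV] at h1
  simp only [Polynomial.map_add, Polynomial.map_mul, Polynomial.map_pow, map_X, map_C,
    Polynomial.map_ofNat, eval_add, eval_mul, eval_pow, eval_X, eval_C, eval_ofNat] at h1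
  have h5 : 0 < ‖(5 : K)‖ := norm_pos_iff.mpr h50
  have hx1 : ‖x‖ ≤ 1 := hx.le
  -- the three lower terms
  have t1 : ‖f (380 * b) * x ^ 9‖ ≤ ‖(5 : K)‖ ^ 2 := by
    rw [norm_mul, norm_pow, hx, one_pow, mul_one, map_mul, norm_mul,
      show f 380 = (5 : K) * (76 : K) by rw [map_ofNat]; norm_num, norm_mul, sq]
    calc ‖(5 : K)‖ * ‖(76 : K)‖ * ‖f b‖ ≤ ‖(5 : K)‖ * 1 * ‖(5 : K)‖ := by
          gcongr
          exact_mod_cast IsUltrametricDist.norm_natCast_le_one K 76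
      _ = ‖(5 : K)‖ * ‖(5 : K)‖ := by ring
  have t2 : ‖f a * (U.map f).eval x‖ ≤ ‖(5 : K)‖ ^ 2 := by
    rw [norm_mul]
    exact (mul_le_mul ha (norm_eval_map_le_one f hf U hx1) (norm_nonneg _) (by positivity)).trans
      (by rw [mul_one])
  have t3 : ‖f (b ^ 2) * (V.map f).eval x‖ ≤ ‖(5 : K)‖ ^ 2 := by
    rw [norm_mul, map_pow, norm_pow]
    exact (mul_le_mul (pow_le_pow_left₀ (norm_nonneg _) hb 2) (norm_eval_map_le_one f hf V hx1)
      (norm_nonneg _) (by positivity)).trans (by rw [mul_one])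
  have ht : ‖f (380 * b) * x ^ 9 + f a * (U.map f).eval x + f (b ^ 2) * (V.map f).eval x‖ ≤
      ‖(5 : K)‖ ^ 2 :=
    (IsUltrametricDist.norm_add_le_max _ _).trans (max_le
      ((IsUltrametricDist.norm_add_le_max _ _).trans (max_le t1 t2)) t3)
  refine ne_zero_of_norm_le_sq h50 h51 hx 12 ht ?_
  linear_combination h1

/-- **No `7`-torsion with unit abscissa off the Kosters–Pannekoek valuation at `7`.** On
`y² = x³ + ax + b` with coefficients in `R`, read in any ultrametric normed field `K` through `f` with
`‖f r‖ ≤ 1`, `0 < ‖7‖ < 1`, `‖f a‖ ≤ ‖7‖` and `‖f b‖ ≤ ‖7‖²`: a point `(x, y)` with `‖x‖ = 1` is not killed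
by `7` (`ψ₇(x) = 7x²⁴ + 308·a·x²² + a²·U(x) + b·V(x)`, `308 = 7·44`).
[cite: SilvermanAEC2009, Exercise 3.7(d),(f)] [cite: KostersPannekoek2017, Thm. 1 (iv) and Cor. 2 (iv)] -/
theorem not_seven_zsmul_eq_zero_of_norm_eq_one (hf : ∀ r, ‖f r‖ ≤ 1) {a b : R}
    [((shortCurve a b).map f).IsElliptic] (h70 : (7 : K) ≠ 0) (h71 : ‖(7 : K)‖ < 1)
    (ha : ‖f a‖ ≤ ‖(7 : K)‖) (hb : ‖f b‖ ≤ ‖(7 : K)‖ ^ 2) {x y : K}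
    (h : ((shortCurve a b).map f).toAffine.Nonsingular x y) (hx : ‖x‖ = 1) :
    (7 : ℤ) • (Affine.Point.some x y h : ((shortCurve a b).map f).toAffine.Point) ≠ 0 := by
  intro h0
  have h1 := eval_map_preΨ'_eq_zero_of_zsmul_eq_zero f (shortCurve a b) (p := 7) (by decide) h
    (by exact_mod_cast h0)
  obtain ⟨U, V, hUV⟩ := exists_preΨ'_seven_eq a b
  rw [hUV] at h1
  simp only [Polynomial.map_add, Polynomial.map_mul, Polynomial.map_pow, map_X, map_C,
    Polynomial.map_ofNat, eval_add, eval_mul, eval_pow, eval_X, eval_C, eval_ofNat] at h1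
  have h7 : 0 < ‖(7 : K)‖ := norm_pos_iff.mpr h70
  have hx1 : ‖x‖ ≤ 1 := hx.le
  have t1 : ‖f (308 * a) * x ^ 22‖ ≤ ‖(7 : K)‖ ^ 2 := by
    rw [norm_mul, norm_pow, hx, one_pow, mul_one, map_mul, norm_mul,
      show f 308 = (7 : K) * (44 : K) by rw [map_ofNat]; norm_num, norm_mul, sq]
    calc ‖(7 : K)‖ * ‖(44 : K)‖ * ‖f a‖ ≤ ‖(7 : K)‖ * 1 * ‖(7 : K)‖ := by
          gcongr
          exact_mod_cast IsUltrametricDist.norm_natCast_le_one K 44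
      _ = ‖(7 : K)‖ * ‖(7 : K)‖ := by ring
  have t2 : ‖f (a ^ 2) * (U.map f).eval x‖ ≤ ‖(7 : K)‖ ^ 2 := by
    rw [norm_mul, map_pow, norm_pow]
    exact (mul_le_mul (pow_le_pow_left₀ (norm_nonneg _) ha 2) (norm_eval_map_le_one f hf U hx1)
      (norm_nonneg _) (by positivity)).trans (by rw [mul_one])
  have t3 : ‖f b * (V.map f).eval x‖ ≤ ‖(7 : K)‖ ^ 2 := by
    rw [norm_mul]
    exact (mul_le_mul hb (norm_eval_map_le_one f hf V hx1) (norm_nonneg _) (by positivity)).trans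
      (by rw [mul_one])
  have ht : ‖f (308 * a) * x ^ 22 + f (a ^ 2) * (U.map f).eval x + f b * (V.map f).eval x‖ ≤
      ‖(7 : K)‖ ^ 2 :=
    (IsUltrametricDist.norm_add_le_max _ _).trans (max_le
      ((IsUltrametricDist.norm_add_le_max _ _).trans (max_le t1 t2)) t3)
  refine ne_zero_of_norm_le_sq h70 h71 hx 24 ht ?_
  linear_combination h1

/-! ## §5 `p ∈ {5, 7}`, abscissa of norm `≥ 1`, over an UNRAMIFIED field -/

/-- **No `p`-torsion with abscissa of norm `≥ 1` at `p ∈ {5, 7}` over an unramified `p`-adic field, off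
the Kosters–Pannekoek valuations.** `K` an ultrametric normed field with `0 < ‖p‖ < 1` and
`‖z‖ < 1 ⇒ ‖z‖ ≤ ‖p‖` (absolute ramification index `1`, e.g. `ℚ(ζ_m)_v` for `p ∤ m`), `y² = x³ + ax + b` with
coefficients in `R` read through `f` (`‖f r‖ ≤ 1`) and `‖f a‖, ‖f b‖ ≤ ‖p‖²` (at a globally minimal curve over
`ℚ` additive at `p` this is `v_p(c₄), v_p(c₆) ≥ 2`, i.e. Kodaira type IV, Iₙ*, IV*, III*, II* — every
type with `4 ≤ v_pΔ_min`, in particular the STARRED locus of K★): no point `(x, y)` with `‖x‖ ≥ 1` is killed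
by `p`. The kernel-of-reduction case `‖x‖ > 1` is the tree's
`UnramifiedKernelTorsion.not_prime_zsmul_eq_zero_of_one_lt_norm_unramified`; the unit case is §4. (The
remaining points, `‖x‖ < 1`, reduce to the cusp and lie outside `E₀(K)`.)
[cite: SilvermanAEC2009, VII.3 Prop. 3.1 and Exercise 3.7(d),(f)] [cite: KostersPannekoek2017, Thm. 1 (iii)-(iv)] -/
theorem not_zsmul_eq_zero_of_one_le_norm_unramified (hf : ∀ r, ‖f r‖ ≤ 1) {p : ℕ} [Fact p.Prime]
    (hp : p = 5 ∨ p = 7) {a b : R} [((shortCurve a b).map f).IsElliptic] (hp0 : (p : K) ≠ 0)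
    (hp1 : ‖(p : K)‖ < 1) (hdisc : ∀ z : K, ‖z‖ < 1 → ‖z‖ ≤ ‖(p : K)‖)
    (ha : ‖f a‖ ≤ ‖(p : K)‖ ^ 2) (hb : ‖f b‖ ≤ ‖(p : K)‖ ^ 2) {x y : K}
    (h : ((shortCurve a b).map f).toAffine.Nonsingular x y) (hx : 1 ≤ ‖x‖) :
    (p : ℤ) • (Affine.Point.some x y h : ((shortCurve a b).map f).toAffine.Point) ≠ 0 := by
  rcases hx.eq_or_lt with hx1 | hx1
  · -- unit abscissa
    have hpK : 0 < ‖(p : K)‖ := norm_pos_iff.mpr hp0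
    have hsq : ‖(p : K)‖ ^ 2 ≤ ‖(p : K)‖ := by nlinarith
    rcases hp with rfl | rfl
    · exact not_five_zsmul_eq_zero_of_norm_eq_one f hf (by exact_mod_cast hp0) (by exact_mod_cast hp1)
        (by exact_mod_cast ha) (by exact_mod_cast (hb.trans hsq)) h hx1.symm
    · exact not_seven_zsmul_eq_zero_of_norm_eq_one f hf (by exact_mod_cast hp0) (by exact_mod_cast hp1)
        (by exact_mod_cast (ha.trans hsq)) (by exact_mod_cast hb) h hx1.symm
  · -- kernel of reduction
    have hp3 : 3 ≤ p := by rcases hp with rfl | rfl <;> norm_num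
    exact UnramifiedKernelTorsion.not_prime_zsmul_eq_zero_of_one_lt_norm_unramified f hf
      (shortCurve a b) hp3 hp0 hp1 hdisc h hx1

end Summit.BirchSwinnertonDyer.BirchSwinnertonDyer.Theorems.StarredOptimalManinUnitFiveSevenUnramifiedTorsion

end
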